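import Summits.NavierStokesRegularity.NavierStokesRegularity.Theorems.CoriolisHeadCounterRotatingLiouvilleCalculus
import Literature.Analysis.FluidPDE.TsaiProfileEndgame

/-!
# Route CoriolisHead · crux `CounterRotatingLiouville` (stmt-NavierStokesRegularity-22677) —
# stub 1 `stub_rotatingHeadIdentity`: the exact Coriolis-head identity

Support file of the line `tsai-rotating-head-chain` (theorems only; `--supports
stmt-NavierStokesRegularity-22677`).  For a smooth rotated Leray profile
`−νΔU + aU + a(y·∇)U + (BU − (By·∇)U) + (U·∇)U + ∇P = 0`, `div U = 0`, `B` skew, the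
**rotating head pressure** `Π_B = ½|U|² + P + a⟨y,U⟩ − ⟨By,U⟩` satisfies, with the drift
`W = U + ay − By` of the similarity variables,

`ν ΔΠ_B − W·∇Π_B = (ν/2) |DU − DUᵀ|² + 2ν Σᵢ ⟪eᵢ, B (DU eᵢ)⟫`

(coordinate-free, `driftOp_rotatingHead_eq`), i.e. on `ℝ³`
`= ½ν Σₗᵢ (∂ₗUᵢ − ∂ᵢUₗ)² + 2ν Σₗ (B ∂ₗU)ₗ` — the registered stub `stub_rotatingHeadIdentity`.
The case `B = 0` is Tsai's (1.7) (`IsLerayProfile.driftOp_headPressure_eq_spin`); the proof is the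
same pairing of the profile system with `U`, `y` and now `By`, plus `Δ⟪By, U⟫ = ⟪By, ΔU⟫ +
2 Σᵢ ⟪B eᵢ, DU eᵢ⟫` and the skewness relations `⟪Bx, z⟫ = −⟪x, Bz⟫`.  NS regularity is NOT proved
here.
-/

noncomputable section

-- the summit and its single sub-problem share the name (CONVENTIONS §1), as in every Theorems file
set_option linter.dupNamespace false

open MeasureTheory Set Function Filter Topology InnerProductSpace Metric
open scoped RealInnerProductSpace Laplacian ContDiff BigOperators
open Literature.Analysis.FluidPDE

namespace Summit.NavierStokesRegularity.NavierStokesRegularity.Theorems.CoriolisHead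

section CoordFree

variable {E : Type*} [NormedAddCommGroup E] [InnerProductSpace ℝ E] [FiniteDimensional ℝ E]

/-- The Laplacian of a continuous linear map vanishes. -/
theorem laplacian_clm_eq_zero (B : E →L[ℝ] E) (x : E) : (Δ (fun y => B y)) x = 0 := by
  have hB2 : ContDiff ℝ 2 (fun y => B y) := B.contDiff
  rw [laplacian_eq_sum_fderiv_fderiv (stdOrthonormalBasis ℝ E) hB2 x]
  refine Finset.sum_eq_zero fun i _ => ?_
  have : (fun y : E => fderiv ℝ (fun y => B y) y (stdOrthonormalBasis ℝ E i)) =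
      fun _ => B (stdOrthonormalBasis ℝ E i) := by
    funext y
    rw [show (fun y => B y) = (B : E → E) from rfl, B.fderiv]
  rw [this, fderiv_fun_const]
  rfl

/-- `Δ⟪By, U⟫ = ⟪By, ΔU⟫ + 2 Σᵢ ⟪B bᵢ, DU bᵢ⟫` for a continuous linear `B`, a `C²` field `U` and
an orthonormal basis `b`. -/
theorem laplacian_inner_clm_eq {ι : Type*} [Fintype ι] (b : OrthonormalBasis ι ℝ E)
    (B : E →L[ℝ] E) {U : E → E} (hU : ContDiff ℝ 2 U) (x : E) :
    (Δ fun y => ⟪B y, U y⟫) x = ⟪B x, (Δ U) x⟫ + 2 * ∑ i, ⟪B (b i), fderiv ℝ U x (b i)⟫ := by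
  have hB2 : ContDiff ℝ 2 (fun y => B y) := B.contDiff
  rw [laplacian_inner_eq b hB2 hU x, laplacian_clm_eq_zero, inner_zero_left, zero_add]
  congr 2
  refine Finset.sum_congr rfl fun i _ => ?_
  rw [show (fun y => B y) = (B : E → E) from rfl, B.fderiv]

omit [FiniteDimensional ℝ E] in
/-- `D⟪By, U⟫(x) w = ⟪Bw, U x⟫ + ⟪Bx, DU(x) w⟫`. -/
theorem fderiv_inner_clm_apply (B : E →L[ℝ] E) {U : E → E} {x : E}
    (hU : DifferentiableAt ℝ U x) (w : E) :
    fderiv ℝ (fun y => ⟪B y, U y⟫) x w = ⟪B w, U x⟫ + ⟪B x, fderiv ℝ U x w⟫ := by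
  rw [fderiv_inner_apply ℝ B.differentiableAt hU, B.fderiv]
  ring

/-- **The exact Coriolis-head identity, coordinate-free.** For `U ∈ C³`, `P ∈ C²`, `B` skew,
`div U = 0` and the rotated profile system, the rotating head `Π_B = Π − ⟪By, U⟫`
(`Π = headPressure a U P`) satisfies
`ν ΔΠ_B − DΠ_B[U − By + ay] = (ν/2)|DU − DUᵀ|² + 2ν Σᵢ ⟪bᵢ, B (DU bᵢ)⟫`
for every orthonormal basis `b` (the last sum is `tr (B ∘ DU)`, the Coriolis defect). -/
theorem driftOp_rotatingHead_eq {ι : Type*} [Fintype ι] (b : OrthonormalBasis ι ℝ E)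
    {ν a : ℝ} {B : E →L[ℝ] E} {U : E → E} {P : E → ℝ}
    (hU3 : ContDiff ℝ 3 U) (hP2 : ContDiff ℝ 2 P) (hB : ∀ x, ⟪B x, x⟫ = 0)
    (hdiv : VectorCalculus.IsDivFree U)
    (heq : ∀ y, -(ν • (Δ U) y) + a • U y + a • fderiv ℝ U y y + (B (U y) - fderiv ℝ U y (B y)) +
      convect U U y + gradient P y = 0) (y : E) :
    driftOp ν a (fun z => U z - B z) (fun z => headPressure a U P z - ⟪B z, U z⟫) y =
      ν / 2 * frobeniusNormSq (spin U y) + 2 * ν * ∑ i, ⟪b i, B (fderiv ℝ U y (b i))⟫ := by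
  haveI : CompleteSpace E := FiniteDimensional.complete ℝ E
  have hU2 : ContDiff ℝ 2 U := hU3.of_le (by norm_num)
  have hU1 : ContDiff ℝ 1 U := hU3.of_le (by norm_num)
  have hUd : Differentiable ℝ U := hU1.differentiable one_ne_zero
  have hPd : Differentiable ℝ P := (hP2.of_le one_le_two).differentiable one_ne_zero
  have hΔP := laplacian_pressure_eq_of_rotated hU3 hP2 hdiv heq y
  -- the pieces of `Π_B = Π - g`, `g = ⟪B·, U⟫`
  have hHead2 : ContDiff ℝ 2 (headPressure a U P) := contDiff_headPressure hU2 hP2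
  have hg2 : ContDiff ℝ 2 (fun z => ⟪B z, U z⟫) := (B.contDiff (n := 2)).inner ℝ hU2
  have hLap : (Δ fun z => headPressure a U P z - ⟪B z, U z⟫) y =
      (Δ (headPressure a U P)) y - (Δ fun z => ⟪B z, U z⟫) y :=
    hHead2.contDiffAt.laplacian_sub hg2.contDiffAt
  have hDer : fderiv ℝ (fun z => headPressure a U P z - ⟪B z, U z⟫) y =
      fderiv ℝ (headPressure a U P) y - fderiv ℝ (fun z => ⟪B z, U z⟫) y :=
    fderiv_fun_sub ((hHead2.differentiable (by norm_num)) y) ((hg2.differentiable (by norm_num)) y)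
  have hLapHead := laplacian_headPressure (a := a) hU2 hP2 y
  have hLapg := laplacian_inner_clm_eq b B hU2 y
  set W : E := (U y - B y) + a • y with hW
  have hDerHead := fderiv_headPressure_apply (a := a) hUd hPd y W
  have hDerg := fderiv_inner_clm_apply B (hUd y) W
  -- the profile equation paired with `U y`, `y`, `B y`
  have hEU : ⟪-(ν • (Δ U) y) + a • U y + a • fderiv ℝ U y y + (B (U y) - fderiv ℝ U y (B y)) +
      convect U U y + gradient P y, U y⟫ = 0 := by rw [heq y, inner_zero_left]
  have hEy : ⟪-(ν • (Δ U) y) + a • U y + a • fderiv ℝ U y y + (B (U y) - fderiv ℝ U y (B y)) +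
      convect U U y + gradient P y, y⟫ = 0 := by rw [heq y, inner_zero_left]
  have hEB : ⟪-(ν • (Δ U) y) + a • U y + a • fderiv ℝ U y y + (B (U y) - fderiv ℝ U y (B y)) +
      convect U U y + gradient P y, B y⟫ = 0 := by rw [heq y, inner_zero_left]
  simp only [inner_add_left, inner_sub_left, inner_neg_left, real_inner_smul_left, convect_apply,
    gradient, InnerProductSpace.toDual_symm_apply] at hEU hEy hEB
  -- skewness relations
  have hBu : ⟪B (U y), U y⟫ = 0 := hB (U y)
  have hsk1 : ⟪B (U y), y⟫ = -⟪U y, B y⟫ := inner_clm_left_eq_neg_of_skew hB _ _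
  have hsk2 : ⟪B (U y), B y⟫ = -⟪U y, B (B y)⟫ := inner_clm_left_eq_neg_of_skew hB _ _
  have hsk3 : ∀ i, ⟪b i, B (fderiv ℝ U y (b i))⟫ = -⟪B (b i), fderiv ℝ U y (b i)⟫ := fun i => by
    rw [inner_clm_left_eq_neg_of_skew hB (b i), neg_neg]
  have hS : ∑ i, ⟪b i, B (fderiv ℝ U y (b i))⟫ = -∑ i, ⟪B (b i), fderiv ℝ U y (b i)⟫ := by
    rw [← Finset.sum_neg_distrib]; exact Finset.sum_congr rfl fun i _ => hsk3 i
  have hspin : frobeniusNormSq (spin U y) =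
      2 * (frobeniusNormSq (fderiv ℝ U y) - traceCLM ((fderiv ℝ U y).comp (fderiv ℝ U y))) :=
    frobeniusNormSq_sub_adjoint _
  -- expand the drift operator
  rw [driftOp, hLap, hDer, sub_apply, hLapHead, hLapg, hΔP, hdiv y, hspin, hS]
  have hWdef : U y - B y + a • y = W := rfl
  rw [hWdef, hDerHead, hDerg]
  -- linearity in `W`
  simp only [hW, map_add, map_sub, map_smul, inner_add_left, inner_sub_left, inner_add_right,
    inner_sub_right, real_inner_smul_left, real_inner_smul_right, smul_eq_mul]
  -- orient the inner products as in `hEU`, `hEy`, `hEB`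
  set L : E := (Δ U : E → E) y with hL
  set D := fderiv ℝ U y with hD
  rw [real_inner_comm L y, real_inner_comm L (B y),
    real_inner_comm (D (U y)) (U y), real_inner_comm (D (B y)) (U y), real_inner_comm (D y) (U y),
    real_inner_comm (D (U y)) y, real_inner_comm (D (B y)) y, real_inner_comm (D y) y,
    real_inner_comm (D (U y)) (B y), real_inner_comm (D (B y)) (B y), real_inner_comm (D y) (B y),
    real_inner_comm (U y) (B y), real_inner_comm (U y) y, real_inner_comm (U y) (B (B y))]
  linear_combination -hEU - a * hEy + hEB + a * hsk1 - hsk2 + 2 * hBu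

end CoordFree

/-! ### Coordinates on `ℝ^ι` and the registered stub -/

section Coord

variable {ι : Type*} [Fintype ι] [DecidableEq ι]

/-- `|DU − DUᵀ|²` in coordinates: `Σₗ Σᵢ (∂ₗUᵢ − ∂ᵢUₗ)²`. -/
theorem frobeniusNormSq_spin_eq_sum {U : EuclideanSpace ℝ ι → EuclideanSpace ℝ ι}
    {y : EuclideanSpace ℝ ι} (hU : DifferentiableAt ℝ U y) :
    frobeniusNormSq (spin U y) =
      ∑ l, ∑ i, (pderiv l (fun z => U z i) y - pderiv i (fun z => U z l) y) ^ 2 := by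
  haveI : CompleteSpace (EuclideanSpace ℝ ι) := FiniteDimensional.complete ℝ _
  have hb : ∀ k, (EuclideanSpace.basisFun ι ℝ) k = (stdVec k : EuclideanSpace ℝ ι) := fun k => by
    simp [stdVec, EuclideanSpace.basisFun_apply]
  have hent : ∀ i j, ⟪(EuclideanSpace.basisFun ι ℝ) i, fderiv ℝ U y ((EuclideanSpace.basisFun ι ℝ) j)⟫ =
      pderiv j (fun z => U z i) y := fun i j => by
    rw [EuclideanSpace.basisFun_inner, hb, pderiv_apply, euclidean_fderiv_apply_comp hU]
  unfold spin
  rw [frobeniusNormSq_eq_sum_sum_sq_inner (EuclideanSpace.basisFun ι ℝ), Finset.sum_comm]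
  refine Finset.sum_congr rfl fun l _ => Finset.sum_congr rfl fun i _ => ?_
  rw [inner_sub_adjoint_apply, hent, hent]

/-- The Coriolis defect in coordinates: `Σₗ ⟪eₗ, B (DU eₗ)⟫ = Σₗ (B (DU eₗ))ₗ`. -/
theorem sum_inner_basisFun_clm_fderiv (B : EuclideanSpace ℝ ι →L[ℝ] EuclideanSpace ℝ ι)
    (U : EuclideanSpace ℝ ι → EuclideanSpace ℝ ι) (y : EuclideanSpace ℝ ι) :
    ∑ l, ⟪(EuclideanSpace.basisFun ι ℝ) l, B (fderiv ℝ U y ((EuclideanSpace.basisFun ι ℝ) l))⟫ =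
      ∑ l, (B (fderiv ℝ U y (EuclideanSpace.single l 1))) l :=
  Finset.sum_congr rfl fun l _ => by
    rw [EuclideanSpace.basisFun_inner, EuclideanSpace.basisFun_apply]

end Coord

/-- **Registered stub `stub_rotatingHeadIdentity`** of the skeleton of crux
`CounterRotatingLiouville` (line `tsai-rotating-head-chain`): the exact Coriolis-head identity on
`ℝ³`, `ν ΔΠ_B − (U − By + ay)·∇Π_B = ½ν Σₗᵢ (∂ₗUᵢ − ∂ᵢUₗ)² + 2ν Σₗ (B ∂ₗU)ₗ` for a smooth rotated
Leray profile with skew `B` (from `driftOp_rotatingHead_eq`). -/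
theorem stub_rotatingHeadIdentity : ∀ (ν a : ℝ) (B : EuclideanSpace ℝ (Fin 3) →L[ℝ] EuclideanSpace ℝ (Fin 3)) (U : EuclideanSpace ℝ (Fin 3) → EuclideanSpace ℝ (Fin 3)) (P : EuclideanSpace ℝ (Fin 3) → ℝ), ContDiff ℝ (⊤ : ℕ∞) U → ContDiff ℝ 2 P → (∀ x, inner ℝ (B x) x = 0) → Literature.Analysis.FluidPDE.VectorCalculus.IsDivFree U → (∀ y, -(ν • Laplacian.laplacian U y) + a • U y + a • fderiv ℝ U y y + (B (U y) - fderiv ℝ U y (B y)) + Literature.Analysis.FluidPDE.convect U U y + gradient P y = 0) → ∀ y, Literature.Analysis.FluidPDE.driftOp ν a (fun z => U z - B z) (fun z => Literature.Analysis.FluidPDE.headPressure a U P z - inner ℝ (B z) (U z)) y = 2⁻¹ * ν * (∑ l, ∑ i, (Literature.Analysis.FluidPDE.pderiv l (fun z => U z i) y - Literature.Analysis.FluidPDE.pderiv i (fun z => U z l) y) ^ 2) + 2 * ν * ∑ l, (B (fderiv ℝ U y (EuclideanSpace.single l 1))) l := by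
  intro ν a B U P hU hP hB hdiv heq y
  have hU3 : ContDiff ℝ 3 U := hU.of_le (by norm_cast)
  rw [driftOp_rotatingHead_eq (EuclideanSpace.basisFun (Fin 3) ℝ) hU3 hP hB hdiv heq y,
    frobeniusNormSq_spin_eq_sum ((hU.differentiable (by simp)) y), sum_inner_basisFun_clm_fderiv]
  ring

end Summit.NavierStokesRegularity.NavierStokesRegularity.Theorems.CoriolisHead

end
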